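import Summits.HubbardSuperconductivity.HubbardSuperconductivity.Theorems.BalabanIRBirEveryGroundStateSchur
import Literature.Computability.AlgebraicComplexity.SubspaceProjection
import HarnessLib

/-!
# Route `BalabanIR`, crux 5 `BirEveryGroundState` (`stmt-HubbardSuperconductivity-2083`):
# the variational sandwich of the κ-chord — finite-dimensional core of the conjugate-source shift

For matrices `H`, `Y`, a sector `K ≤ ℂⁿ` and `κ > 0`, the κ-chord
`(E_K(H + κY) - E_K(H)) / κ` (`E_K = Matrix.minEnergyOn · K`) is sandwiched by two one-line
variational bounds:

* `chord_div_le_re_expect_of_eigen` (companion `…Schur`): `chord/κ ≤ re ⟨ψ, Y ψ⟩` for every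
  normalised sector ground state `ψ` of `H` (`ψ` is a trial state for `H + κY`);
* `re_rayleigh_le_chord_div_of_penalisedGround` (here): `re ⟨φ, Y φ⟩ ≤ chord/κ` for every
  normalised sector ground state `φ` of the PENALISED `H + κY` (`φ` is a trial state for `H`).

Hence `re_rayleigh_penalisedGround_le_re_rayleigh_ground`: `re ⟨φ, Y φ⟩ ≤ re ⟨ψ, Y ψ⟩` — penalising
`Y` selects the `Y`-poorest states, whose `Y`-content bounds that of EVERY unpenalised ground state
from below (no hermiticity, no degeneracy count, no genericity). With the pigeonhole over an
orthonormal frame of the penalised ground compression (inlined from Literature's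
`SubspaceProjection` frame calculus; the route-file-importing `Theorems.exists_unit_le_re_of_trace_projMatrix_map`
cannot serve a closing module) this gives the ABSTRACT CLOSER
`forall_ground_le_re_rayleigh_of_penalised_trace_le`: a ground-state-AVERAGE bound
`c · re tr P_κ ≤ re tr (P_κ Y)` over the ground compression of the penalised matrix — the SHAPE of
the route's target `BirGroundStateAverageLRO` — forces `c ≤ re ⟨ψ, Y ψ⟩` for every normalised sector
ground state `ψ` of `H`. The Hubbard specialisation (crux 5 dissolved by a conjugate-source shift,
summit-shaped re-cut) is `BalabanIRBirEveryGroundStateSourceShift.lean`.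

This module imports NO route file (rev-5 materialisation rule). Sources: R. B. Griffiths,
J. Math. Phys. 5 (1964) 1215, §III (one-sided derivatives of concave ground/free energies select
extremal states); B. Simon, *The Statistical Mechanics of Lattice Gases* I (1993) §III.1;
Koma–Tasaki, J. Stat. Phys. 76 (1994) 745 §1; Tasaki (2020) §2.1, App. A.2. Folklore; no definition
is introduced.

## Mathlib / tree search

REUSED: `Theorems.minEnergyOn_le_re_rayleigh`, `Theorems.chord_div_le_re_expect_of_eigen`
(`…Schur`, route-file-free), `Literature.Computability.AlgebraicComplexity.exists_orthonormalFrame` /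
`proj_unique` / `frame_proj_trace` / `frame_proj_mulVec_mem`, `projMatrix_map_mulVec_of_mem`,
`projMatrix_map_mulVec_mem` (`LTQOProofs`); Mathlib `Module.End.mem_eigenspace_iff`,
`Finset.exists_le_of_sum_le`. `lean search "penalis|chord_div|shifted"`: only the upper chord bound
exists (`…Schur`, `…Closures`); the lower bound and the sandwich are new here.
-/

noncomputable section

open scoped Matrix.Norms.L2Operator ComplexOrder MatrixOrder InnerProductSpace

namespace Summit.HubbardSuperconductivity.HubbardSuperconductivity.Theorems

open Matrix Finset Filter Literature.MathematicalPhysics.QuantumLattice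
open Literature.Computability.AlgebraicComplexity

/-! ### The variational sandwich of the κ-chord -/

section Abstract

variable {n : Type*} [Fintype n] [DecidableEq n]

omit [DecidableEq n] in
/-- **The lower chord inequality.** For matrices `H`, `Y`, a sector `K`, `κ > 0` and a unit vector
`φ ∈ K` of penalised energy `re ⟨φ, (H + κY) φ⟩ = minEnergyOn (H + κY) K` (a sector ground state of
the PENALISED matrix): `re ⟨φ, Y φ⟩ ≤ (minEnergyOn (H + κY) K - minEnergyOn H K) / κ` — `φ` is a
trial state for `H`: `minEnergyOn H K ≤ re ⟨φ, H φ⟩ = minEnergyOn (H + κY) K - κ re ⟨φ, Y φ⟩`. No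
hermiticity is needed. Griffiths, J. Math. Phys. 5 (1964) 1215 §III; Simon (1993) §III.1. [folklore] -/
theorem re_rayleigh_le_chord_div_of_penalisedGround (H Y : Matrix n n ℂ) (K : Submodule ℂ (n → ℂ))
    {κ : ℝ} (hκ : 0 < κ) {φ : n → ℂ} (hφK : φ ∈ K) (hφ : star φ ⬝ᵥ φ = 1)
    (hground : (star φ ⬝ᵥ (H + (κ : ℂ) • Y) *ᵥ φ).re = (H + (κ : ℂ) • Y).minEnergyOn K) :
    (star φ ⬝ᵥ Y *ᵥ φ).re ≤ ((H + (κ : ℂ) • Y).minEnergyOn K - H.minEnergyOn K) / κ := by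
  have h1 := minEnergyOn_le_re_rayleigh H K hφK hφ
  rw [add_mulVec, dotProduct_add, Complex.add_re, smul_mulVec, dotProduct_smul, smul_eq_mul,
    Complex.re_ofReal_mul] at hground
  rw [le_div_iff₀ hκ]
  linarith

omit [DecidableEq n] in
/-- The lower chord inequality for a penalised sector ground state in eigenvector form:
`(H + κY) φ = minEnergyOn (H + κY) K • φ`, `φ ∈ K` a unit vector. [folklore] -/
theorem re_rayleigh_le_chord_div_of_penalisedGround_eigen (H Y : Matrix n n ℂ)
    (K : Submodule ℂ (n → ℂ)) {κ : ℝ} (hκ : 0 < κ) {φ : n → ℂ} (hφK : φ ∈ K)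
    (hφ : star φ ⬝ᵥ φ = 1)
    (heig : (H + (κ : ℂ) • Y) *ᵥ φ = ((((H + (κ : ℂ) • Y).minEnergyOn K : ℝ)) : ℂ) • φ) :
    (star φ ⬝ᵥ Y *ᵥ φ).re ≤ ((H + (κ : ℂ) • Y).minEnergyOn K - H.minEnergyOn K) / κ := by
  refine re_rayleigh_le_chord_div_of_penalisedGround H Y K hκ hφK hφ ?_
  rw [heig, dotProduct_smul, hφ, smul_eq_mul, mul_one, Complex.ofReal_re]

omit [DecidableEq n] in
/-- **The sandwich: penalised ground states are `Y`-poorer than every unpenalised ground state.**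
For matrices `H`, `Y`, a sector `K`, `κ > 0`, a normalised sector ground state `φ` of `H + κY` and a
normalised sector ground state `ψ` of `H` (eigenvector forms): `re ⟨φ, Y φ⟩ ≤ re ⟨ψ, Y ψ⟩` (the chord
`(minEnergyOn (H + κY) K - minEnergyOn H K)/κ` lies in between: `re_rayleigh_le_chord_div_of_penalisedGround_eigen`
and `chord_div_le_re_expect_of_eigen`). This is the finite-volume content of "the one-sided
derivatives of the concave function `κ ↦ E_K(H + κY)` are the extremal `Y`-expectations over the
ground states" (Griffiths). Griffiths, J. Math. Phys. 5 (1964) 1215 §III; Koma–Tasaki,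
J. Stat. Phys. 76 (1994) 745 §1. [folklore] -/
theorem re_rayleigh_penalisedGround_le_re_rayleigh_ground (H Y : Matrix n n ℂ)
    (K : Submodule ℂ (n → ℂ)) {κ : ℝ} (hκ : 0 < κ) {φ ψ : n → ℂ} (hφK : φ ∈ K)
    (hφ : star φ ⬝ᵥ φ = 1)
    (hφeig : (H + (κ : ℂ) • Y) *ᵥ φ = ((((H + (κ : ℂ) • Y).minEnergyOn K : ℝ)) : ℂ) • φ)
    (hψK : ψ ∈ K) (hψ : star ψ ⬝ᵥ ψ = 1) (hψeig : H *ᵥ ψ = ((H.minEnergyOn K : ℝ) : ℂ) • ψ) :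
    (star φ ⬝ᵥ Y *ᵥ φ).re ≤ (star ψ ⬝ᵥ Y *ᵥ ψ).re :=
  (re_rayleigh_le_chord_div_of_penalisedGround_eigen H Y K hκ hφK hφ hφeig).trans
    (chord_div_le_re_expect_of_eigen H Y K hκ hψK hψ hψeig)

/-- **ABSTRACT CLOSER: the ground-state AVERAGE of the PENALISED matrix bounds EVERY ground state of
the unpenalised one.** For matrices `H`, `Y`, a sector `K` and `κ > 0`, let
`E_κ = K ⊓ ker (H + κY - minEnergyOn (H + κY) K)` be the sector ground eigenspace of the penalised
matrix (assumed `≠ ⊥`; automatic for Hermitian data preserving `K ≠ ⊥`) and `P_κ` its orthogonal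
projection. If `c · re tr P_κ ≤ re tr (P_κ Y)` — the SHAPE of the target `BirGroundStateAverageLRO`,
for `H + κY` in place of `H` — then `c ≤ re ⟨ψ, Y ψ⟩` for every normalised sector ground state `ψ` of
`H` (`ψ ∈ K`, `H ψ = minEnergyOn H K • ψ`): writing `P_κ = B Bᴴ` for an orthonormal frame `B` of
`E_κ` (`exists_orthonormalFrame`, `proj_unique`), `re tr (P_κ Y) = Σ_j re ⟨b_j, Y b_j⟩` and
`re tr P_κ = dim E_κ ≥ 1`, so some column `φ = b_j ∈ E_κ` carries `c ≤ re ⟨φ, Y φ⟩` (pigeonhole), and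
`re ⟨φ, Y φ⟩ ≤ re ⟨ψ, Y ψ⟩` (sandwich). Griffiths (1964) §III; Simon (1993) §III.1;
Tasaki (2020) App. A.2. [folklore] -/
theorem forall_ground_le_re_rayleigh_of_penalised_trace_le (H Y : Matrix n n ℂ)
    (K : Submodule ℂ (n → ℂ)) {κ : ℝ} (hκ : 0 < κ) (c : ℝ)
    (hE : K ⊓ Module.End.eigenspace (Matrix.toLin' (H + (κ : ℂ) • Y))
        ((((H + (κ : ℂ) • Y).minEnergyOn K : ℝ)) : ℂ) ≠ ⊥)
    (h : c * (projMatrix ((K ⊓ Module.End.eigenspace (Matrix.toLin' (H + (κ : ℂ) • Y))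
          ((((H + (κ : ℂ) • Y).minEnergyOn K : ℝ)) : ℂ)).map
          ((WithLp.linearEquiv 2 ℂ (n → ℂ)).symm : (n → ℂ) →ₗ[ℂ] EuclideanSpace ℂ n))).trace.re ≤
      (projMatrix ((K ⊓ Module.End.eigenspace (Matrix.toLin' (H + (κ : ℂ) • Y))
          ((((H + (κ : ℂ) • Y).minEnergyOn K : ℝ)) : ℂ)).map
          ((WithLp.linearEquiv 2 ℂ (n → ℂ)).symm : (n → ℂ) →ₗ[ℂ] EuclideanSpace ℂ n)) *
        Y).trace.re)
    {ψ : n → ℂ} (hψK : ψ ∈ K) (hψ : star ψ ⬝ᵥ ψ = 1)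
    (hψeig : H *ᵥ ψ = ((H.minEnergyOn K : ℝ) : ℂ) • ψ) :
    c ≤ (star ψ ⬝ᵥ Y *ᵥ ψ).re := by
  -- pigeonhole over an orthonormal frame `B` of the penalised ground compression `E`:
  -- `P_E = B Bᴴ`, `re tr (P_E Y) = Σ_j re ⟨b_j, Y b_j⟩`, `re tr P_E = dim E ≥ 1`
  set E : Submodule ℂ (n → ℂ) := K ⊓ Module.End.eigenspace (Matrix.toLin' (H + (κ : ℂ) • Y))
    ((((H + (κ : ℂ) • Y).minEnergyOn K : ℝ)) : ℂ) with hEdef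
  obtain ⟨k, B, hk, hBB, hcol, hfix⟩ := exists_orthonormalFrame E
  have hP : projMatrix (E.map
      ((WithLp.linearEquiv 2 ℂ (n → ℂ)).symm : (n → ℂ) →ₗ[ℂ] EuclideanSpace ℂ n)) = B * Bᴴ :=
    proj_unique (projMatrix_isHermitian _) (Matrix.isHermitian_mul_conjTranspose_self B)
      (fun _ hw => projMatrix_map_mulVec_of_mem E hw) (projMatrix_map_mulVec_mem E) hfix
      (frame_proj_mulVec_mem hcol)
  have hdiag : ∀ j : Fin k,
      (Bᴴ * (Y * B)) j j = star (fun x => B x j) ⬝ᵥ Y *ᵥ (fun x => B x j) := by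
    intro j
    simp only [Matrix.mul_apply, Matrix.conjTranspose_apply, dotProduct, Matrix.mulVec,
      Pi.star_apply]
  have hunit : ∀ j : Fin k, star (fun x => B x j) ⬝ᵥ (fun x => B x j) = 1 := by
    intro j
    have := congrFun (congrFun hBB j) j
    simpa [Matrix.mul_apply, Matrix.conjTranspose_apply, dotProduct, Matrix.one_apply] using this
  have hkpos : 0 < k := by
    rw [hk]
    exact Submodule.one_le_finrank_iff.mpr hE
  rw [hP, frame_proj_trace hBB, Matrix.mul_assoc, Matrix.trace_mul_comm, Matrix.mul_assoc,
    Matrix.trace] at h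
  simp only [Matrix.diag_apply, Complex.re_sum, Complex.natCast_re] at h
  have hsum : ∑ _j : Fin k, c ≤ ∑ j : Fin k, ((Bᴴ * (Y * B)) j j).re := by
    simpa [mul_comm] using h
  haveI : Nonempty (Fin k) := ⟨⟨0, hkpos⟩⟩
  obtain ⟨j, -, hj⟩ := Finset.exists_le_of_sum_le Finset.univ_nonempty hsum
  rw [hdiag] at hj
  -- the good column is a penalised sector ground state; apply the sandwich
  have hφE : (fun x => B x j) ∈ E := hcol j
  rw [hEdef, Submodule.mem_inf, Module.End.mem_eigenspace_iff, Matrix.toLin'_apply] at hφE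
  exact hj.trans
    (re_rayleigh_penalisedGround_le_re_rayleigh_ground H Y K hκ hφE.1 (hunit j) hφE.2 hψK hψ
      hψeig)

/-- **Registered form** (sub-goal `penalisedAverageForcesEveryGround` of item
`stmt-HubbardSuperconductivity-2083`): `forall_ground_le_re_rayleigh_of_penalised_trace_le` as a
closed proposition over `n : Type`. [folklore] -/
theorem penalisedAverageForcesEveryGround : ∀ {n : Type} [Fintype n] [DecidableEq n] (H Y : Matrix n n ℂ) (K : Submodule ℂ (n → ℂ)) (κ c : ℝ), 0 < κ → K ⊓ Module.End.eigenspace (Matrix.toLin' (H + (κ : ℂ) • Y)) ((((H + (κ : ℂ) • Y).minEnergyOn K : ℝ)) : ℂ) ≠ ⊥ → c * (Literature.MathematicalPhysics.QuantumLattice.projMatrix ((K ⊓ Module.End.eigenspace (Matrix.toLin' (H + (κ : ℂ) • Y)) ((((H + (κ : ℂ) • Y).minEnergyOn K : ℝ)) : ℂ)).map ((WithLp.linearEquiv 2 ℂ (n → ℂ)).symm : (n → ℂ) →ₗ[ℂ] EuclideanSpace ℂ n))).trace.re ≤ (Literature.MathematicalPhysics.QuantumLattice.projMatrix ((K ⊓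 Module.End.eigenspace (Matrix.toLin' (H + (κ : ℂ) • Y)) ((((H + (κ : ℂ) • Y).minEnergyOn K : ℝ)) : ℂ)).map ((WithLp.linearEquiv 2 ℂ (n → ℂ)).symm : (n → ℂ) →ₗ[ℂ] EuclideanSpace ℂ n)) * Y).trace.re → ∀ (ψ : n → ℂ), ψ ∈ K → star ψ ⬝ᵥ ψ = 1 → H *ᵥ ψ = ((H.minEnergyOn K : ℝ) : ℂ) • ψ → c ≤ (star ψ ⬝ᵥ Y *ᵥ ψ).re :=
  fun H Y K _ c hκ hE h _ hψK hψ hψeig =>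
    forall_ground_le_re_rayleigh_of_penalised_trace_le H Y K hκ c hE h hψK hψ hψeig

end Abstract

end Summit.HubbardSuperconductivity.HubbardSuperconductivity.Theorems
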